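import Literature.ModelTheory.ExponentialFields.ModelTheoryPreds
import Literature.ModelTheory.UniversalTheories.HerbrandSaturation
import Mathlib.ModelTheory.DirectLimit
import Mathlib.ModelTheory.ElementaryMaps
import HarnessLib

/-!
# Robinson's test for model completeness (proved)

Trunk `TranscendEllArithS` / generic model theory, in support of the named fact
`Literature.ModelTheory.ExponentialFields.wilkie_isModelComplete` (`Literature/ModelTheory/ExponentialFields/RealExpField.lean`,
Wilkie's theorem: `Th(ℝ_exp)` is model complete), whose printed proof (Wilkie, JAMS 9 (1996);
Wilkie, *Model theory of analytic and smooth functions*, in *Models and Computability*, LMS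
Lecture Note Ser. 259 (1999), p. 414) starts: "The proof uses Robinson's Test for model
completeness ...".  This file states and **proves** Robinson's test for Mathlib's first-order
logic and the tree's predicate `FirstOrder.Language.Theory.IsModelComplete`
(`ModelTheoryPreds.lean`):

* `FirstOrder.Language.Theory.ModelsExistentiallyClosed T` (definition): for all models
  `M`, `N` of `T` and every embedding `f : M ↪[L] N`, `M` is existentially closed in `N` via `f`
  (`M ≺₁ N`: every universal formula with parameters from `M` true in `M` is true in `N`;
  Tent–Ziegler, *A Course in Model Theory* (2012), Lemma 3.2.7 (b) and the definition of `≺₁`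
  after it).  Phrased with the tree's `Literature.ModelTheory.UniversalTheories.PreservesUniversal`
  (`UniversalTheories/HerbrandSaturation.lean`).
* `Literature.ModelTheory.ModelCompleteness.robinsonTest` (named statement) and `Literature.ModelTheory.ModelCompleteness.robinsonTest_holds` (its proof):
  **Robinson's test**, `T.ModelsExistentiallyClosed → T.IsModelComplete`
  (Tent–Ziegler 2012, Lemma 3.2.7, (b) ⇒ (a); A. Robinson 1956); the converse is
  `IsModelComplete.modelsExistentiallyClosed`, and `Literature.ModelTheory.ModelCompleteness.isModelComplete_iff_modelsExistentiallyClosed`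
  is the equivalence.

The proof is the classical chain argument (Tent–Ziegler 2012, proofs of Thm. 3.1.8 and
Thm. 3.2.9, with Thm. 2.1.4):

1. `Literature.ModelTheory.UniversalTheories.PreservesUniversal.exists_realize_of_isQF`: a `Σ₁`-map `f : M → N` reflects
   solvability of quantifier-free conditions with parameters from `M` in any number of unknowns.
2. `Literature.ModelTheory.UniversalTheories.PreservesUniversal.exists_elementaryEmbedding` (existential amalgamation,
   Tent–Ziegler 2012, Lemma 3.1.2 applied to `Th(M_M)` and `Δ = ∃`-formulas): if `M ≺₁ N` via `f`
   then `N` embeds, over `M`, into an elementary extension `K` of `M`.  Proof: compactness for the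
   elementary diagram of `M` together with the quantifier-free diagram of `N`
   (via `Literature.ModelTheory.UniversalTheories.isSatisfiable_union_image_equivSentence_iff`).
3. `Literature.ModelTheory.ModelCompleteness.realize_directLimit_of` (**Tarski's chain lemma**, Tent–Ziegler 2012,
   Thm. 2.1.4, in the slightly more general form needed here): in a directed system of
   structures (Mathlib's `FirstOrder.Language.DirectLimit`), if the transition maps between the
   members of a *cofinal* subfamily `S` are elementary, then every member of `S` embeds
   elementarily into the direct limit.
4. `Literature.ModelTheory.ModelCompleteness.robinsonTest_holds`: given models `M ↪ N`, iterate (2) to get the interleaved chain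
   `M = A₀ ↪ N = A₁ ↪ A₂ ↪ A₃ ↪ ⋯` in which every double step `Aₖ ↪ Aₖ₊₂` is elementary
   (`Literature.ModelTheory.ModelCompleteness.ecChain`); by (3) applied to the even and to the odd indices, `A₀` and `A₁`
   embed elementarily into the direct limit, hence `M ↪ N` is elementary.

## Mathlib search

Mathlib (this pin) has `FirstOrder.Language.DirectLimit` (with `of`, `of_f`, `exists_of`,
`DirectedSystem.natLERec`), `ElementaryEmbedding`, `elementaryDiagram`, compactness
(`Theory.isSatisfiable_iff_isFinitelySatisfiable`), `IsQF.realize_embedding`, but no model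
completeness, no Robinson test, no existentially closed structures and no Tarski–Vaught chain
lemma (`rg -i 'model.?complete|Robinson|existentially closed|elementary chain'
Mathlib/ModelTheory` finds nothing relevant).

## Design choices

* Universe conventions follow `Theory.IsModelComplete` (`ModelTheoryPreds.lean`): models range
  over `Theory.ModelType.{u, v, max u v} T`; the amalgam `K` of step (2) is produced by
  `isSatisfiable_union_image_equivSentence_iff` in `Type (max u v w)`, which for
  `w = max u v` is again `Type (max u v)`, so the chain stays inside one universe and Mathlib's
  `DirectLimit` applies.
* Parameters are variables indexed by the structure (as in `HerbrandSaturation.lean`), so no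
  iterated constant expansions `L[[M]][[N]]` are needed: the elementary diagram of `M` is the set
  of `L`-formulas with variables in `M` true in `M`, transported to variables in `N` along `f`.
* `robinsonTest` is kept as a named statement `def robinsonTest : Prop` (the form in which
  `WilkieModelCompleteness.lean` consumes it) together with its proof `robinsonTest_holds`.

## References

* K. Tent, M. Ziegler, *A Course in Model Theory*, Lecture Notes in Logic 40, CUP (2012):
  Lemma 3.1.2, Thm. 2.1.4 (Tarski's Chain Lemma), Def. 3.2.6, Lemma 3.2.7 (Robinson's Test).
* A. Robinson, *Complete theories*, North-Holland (1956).
* A. J. Wilkie, *Model theory of analytic and smooth functions*, in: Models and Computability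
  (Leeds 1997), LMS Lecture Note Ser. 259, CUP (1999), 407–419, p. 414.
-/

universe u v w w'

open FirstOrder FirstOrder.Language FirstOrder.Language.BoundedFormula
open Set

/-! ## Existentially closed models and the statement of Robinson's test -/

namespace FirstOrder.Language.Theory

variable {L : FirstOrder.Language.{u, v}}

/-- A theory `T` *has existentially closed models* (condition (b) of Robinson's test,
Tent–Ziegler 2012, Lemma 3.2.7; the relation `M ≺₁ N` defined after it) if for all models
`M`, `N` of `T` and every embedding `f : M ↪[L] N`, `M` is existentially closed in `N` via `f`:
every universal formula with parameters from `M` that holds in `M` holds in `N` (equivalently,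
every existential formula with parameters from `M` that holds in `N` holds in `M`).  Expressed
with `Literature.ModelTheory.UniversalTheories.PreservesUniversal`; models range over `Theory.ModelType.{u, v, max u v} T`
as in `Theory.IsModelComplete`.  A definition (predicate on `T`), not a claim. [cite: TentZiegler2012, Lemma 3.2.7] -/
def ModelsExistentiallyClosed (T : L.Theory) : Prop :=
  ∀ (M N : Theory.ModelType.{u, v, max u v} T) (f : M ↪[L] N),
    Literature.ModelTheory.UniversalTheories.PreservesUniversal L f

/-- Unfolding lemma for `Theory.ModelsExistentiallyClosed`. [cite: TentZiegler2012, Lemma 3.2.7] -/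
theorem modelsExistentiallyClosed_iff (T : L.Theory) :
    T.ModelsExistentiallyClosed ↔
      ∀ (M N : Theory.ModelType.{u, v, max u v} T) (f : M ↪[L] N),
        Literature.ModelTheory.UniversalTheories.PreservesUniversal L f :=
  Iff.rfl

/-- In a model complete theory every embedding between models is elementary; packaged as
Mathlib's `ElementaryEmbedding` (Tent–Ziegler 2012, Def. 3.2.6). [cite: TentZiegler2012, Def. 3.2.6] -/
def IsModelComplete.toElementaryEmbedding {T : L.Theory} (h : T.IsModelComplete)
    (M N : Theory.ModelType.{u, v, max u v} T) (f : M ↪[L] N) : M ↪ₑ[L] N :=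
  ⟨f, @fun n ψ x => h M N f n ψ x⟩

/-- The elementary embedding of `IsModelComplete.toElementaryEmbedding` is `f` as a map. [folklore] -/
@[simp]
theorem IsModelComplete.coe_toElementaryEmbedding {T : L.Theory} (h : T.IsModelComplete)
    (M N : Theory.ModelType.{u, v, max u v} T) (f : M ↪[L] N) :
    ⇑(h.toElementaryEmbedding M N f) = f :=
  rfl

/-- The easy half of Robinson's test (Tent–Ziegler 2012, Lemma 3.2.7, (a) ⇒ (b)): in a model
complete theory every model is existentially closed in every extension model. [cite: TentZiegler2012, Lemma 3.2.7] -/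
theorem IsModelComplete.modelsExistentiallyClosed {T : L.Theory} (h : T.IsModelComplete) :
    T.ModelsExistentiallyClosed := by
  intro M N f φ _ hφ
  have key := (h.toElementaryEmbedding M N f).map_formula φ (_root_.id : M → M)
  rw [IsModelComplete.coe_toElementaryEmbedding] at key
  exact key.2 hφ

end FirstOrder.Language.Theory

namespace Literature.ModelTheory.ModelCompleteness

/-- **Robinson's test** (A. Robinson 1956; Tent–Ziegler, *A Course in Model Theory* (2012),
Lemma 3.2.7, (b) ⇒ (a)): if every model of `T` is existentially closed in every model of `T`
extending it, then `T` is model complete.  Named statement; proved below as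
`Literature.ModelTheory.ModelCompleteness.robinsonTest_holds`. [cite: TentZiegler2012, Lemma 3.2.7] -/
def robinsonTest : Prop :=
  ∀ {L : FirstOrder.Language.{u, v}} (T : L.Theory), T.ModelsExistentiallyClosed → T.IsModelComplete

end Literature.ModelTheory.ModelCompleteness

namespace Literature.ModelTheory.ModelCompleteness

variable {L : FirstOrder.Language.{u, v}}

/-! ## Step 1: `Σ₁`-maps reflect solvability of quantifier-free conditions -/

section Reflect

variable {M : Type w} {N : Type w'} [L.Structure M] [L.Structure N] {f : M → N}

/-- If `f : M → N` preserves universal formulas with parameters (i.e. `M ≺₁ N` via `f`) then `f`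
reflects solvability of quantifier-free conditions: for a quantifier-free `χ(ā, ȳ)` with
parameters `ā` from `M` and unknowns `ȳ` indexed by an arbitrary type `β`, if `N ⊨ χ(f ā, ē)`
for some `ē` then `M ⊨ χ(ā, w̄)` for some `w̄` (Tent–Ziegler 2012, remark after Lemma 3.2.7:
`≺₁` in terms of existential formulas; the reduction to finitely many unknowns uses
`BoundedFormula.restrictFreeVar`). [cite: TentZiegler2012, Lemma 3.2.7] -/
theorem _root_.Literature.ModelTheory.UniversalTheories.PreservesUniversal.exists_realize_of_isQF [Nonempty M] (hf : UniversalTheories.PreservesUniversal L f)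
    {β : Type*} {χ : L.Formula (M ⊕ β)} (hχ : χ.IsQF) {e : β → N}
    (h : χ.Realize (Sum.elim f e)) : ∃ w : β → M, χ.Realize (Sum.elim _root_.id w) := by
  classical
  by_contra hcon
  obtain ⟨m₀⟩ := ‹Nonempty M›
  -- restrict `χ` to the finitely many variables it uses; keep the `M`-variables as they are
  let s : Finset (M ⊕ β) := BoundedFormula.freeVarFinset χ
  let ρ : ↥s → M ⊕ ↥s := fun a => Sum.elim (fun m => Sum.inl m) (fun _ => Sum.inr a) (a : M ⊕ β)
  let χ₁ : L.Formula (M ⊕ ↥s) := BoundedFormula.restrictFreeVar χ ρ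
  have hχ₁ : χ₁.IsQF := hχ.restrictFreeVar ρ
  -- the universal formula `∀ ȳ ¬ χ₁(ā, ȳ)` holds in `M` ...
  have hU : (Formula.iAlls (↥s) χ₁.not).IsUniversal := by
    unfold Formula.iAlls
    exact (hχ₁.not.relabel _).isUniversal_alls
  have hM : (Formula.iAlls (↥s) χ₁.not).Realize (_root_.id : M → M) := by
    rw [Formula.realize_iAlls]
    intro i
    rw [Formula.realize_not]
    intro hi
    let w : β → M := fun b => if hb : Sum.inr b ∈ s then i ⟨Sum.inr b, hb⟩ else m₀
    have key : BoundedFormula.Realize χ₁ (fun a => Sum.elim _root_.id i a) default ↔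
        BoundedFormula.Realize χ (Sum.elim _root_.id w) default := by
      refine BoundedFormula.realize_restrictFreeVar (Sum.elim _root_.id w) (fun a => ?_)
      rcases a with ⟨m | b, ha⟩
      · rfl
      · have hb : Sum.inr b ∈ s := ha
        simp [ρ, w, hb]
    exact hcon ⟨w, key.1 hi⟩
  -- ... hence in `N`, contradicting `N ⊨ χ₁(f ā, ē)`
  have hN := hf hU hM
  rw [Formula.realize_iAlls] at hN
  have hN' := hN (fun a => Sum.elim f e (a : M ⊕ β))
  rw [Formula.realize_not] at hN'
  apply hN'
  have key : BoundedFormula.Realize χ₁ (fun a => Sum.elim f (fun a : ↥s => Sum.elim f e (a : M ⊕ β)) a)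
      default ↔ BoundedFormula.Realize χ (Sum.elim f e) default := by
    refine BoundedFormula.realize_restrictFreeVar (Sum.elim f e) (fun a => ?_)
    rcases a with ⟨m | b, ha⟩ <;> rfl
  exact key.2 h

end Reflect

/-! ## Step 2: existential amalgamation (compactness + diagrams) -/

section Amalgamation

variable {N : Type w} {K : Type w'} [L.Structure N] [L.Structure K]

/-- A map realizing in `K` every quantifier-free formula with parameters from `N` that is true
in `N` (i.e. `K` is a model of the quantifier-free diagram of `N` via `v`) commutes with the
evaluation of terms. [folklore] -/
theorem realize_term_of_realizeQF {v : N → K}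
    (hv : ∀ ψ : L.Formula N, ψ.IsQF → ψ.Realize (_root_.id : N → N) → ψ.Realize v)
    {β : Type*} (t : L.Term β) (w : β → N) : t.realize (v ∘ w) = v (t.realize w) := by
  have h := hv (Term.equal (t.relabel w) (Term.var (t.realize w))) (IsAtomic.equal _ _).isQF
    (by simp)
  simpa [Term.realize_relabel] using h

/-- A model of the quantifier-free diagram of `N` (via `v : N → K`) is an extension of `N`:
`v` is an embedding of `L`-structures (the correspondence between models of `Diag(N)` and
embeddings of `N`, used in Tent–Ziegler 2012, proof of Lemma 3.1.2: "the models `(𝔅, f(a))` of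
this theory correspond to maps `f : 𝔄 →_Δ 𝔅`"). [cite: TentZiegler2012, Lemma 3.1.2] -/
noncomputable def embeddingOfRealizeQF (v : N → K)
    (hv : ∀ ψ : L.Formula N, ψ.IsQF → ψ.Realize (_root_.id : N → N) → ψ.Realize v) :
    N ↪[L] K where
  toFun := v
  inj' := by
    intro a b hab
    by_contra hne
    have h := hv (∼(Term.equal (Term.var a) (Term.var b))) ((IsAtomic.equal _ _).isQF.not)
      (by simpa using hne)
    exact absurd hab (by simpa using h)
  map_fun' := fun F x => by
    have h := realize_term_of_realizeQF hv (Term.func F Term.var) x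
    simp only [Term.realize] at h
    exact h.symm
  map_rel' := fun R x => by
    constructor
    · intro h
      by_contra hx
      have h' := hv (∼(R.formula fun i => Term.var (x i))) ((IsAtomic.rel _ _).isQF.not)
        (by simpa using hx)
      simp only [Formula.realize_not, Formula.realize_rel, Term.realize_var] at h'
      exact h' h
    · intro h
      have h' := hv (R.formula fun i => Term.var (x i)) (IsAtomic.rel _ _).isQF (by simpa using h)
      simp only [Formula.realize_rel, Term.realize_var] at h'
      exact h'

/-- `embeddingOfRealizeQF v hv` is `v` as a map. [folklore] -/
@[simp]
theorem coe_embeddingOfRealizeQF (v : N → K)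
    (hv : ∀ ψ : L.Formula N, ψ.IsQF → ψ.Realize (_root_.id : N → N) → ψ.Realize v) :
    ⇑(embeddingOfRealizeQF v hv) = v :=
  rfl

/-- Conjunctions of lists of quantifier-free formulas are quantifier-free. [folklore] -/
theorem isQF_foldr_inf {α : Type*} {n : ℕ} {l : List (L.BoundedFormula α n)}
    (h : ∀ φ ∈ l, φ.IsQF) : (l.foldr (· ⊓ ·) ⊤).IsQF := by
  induction l with
  | nil => exact IsQF.top
  | cons φ l ih => exact (h φ (by simp)).inf (ih fun ψ hψ => h ψ (by simp [hψ]))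

/-- Finite conjunctions of quantifier-free formulas are quantifier-free. [folklore] -/
theorem isQF_iInf {α : Type*} {n : ℕ} {β : Type*} [Finite β] {g : β → L.BoundedFormula α n}
    (h : ∀ b, (g b).IsQF) : (BoundedFormula.iInf g).IsQF := by
  unfold BoundedFormula.iInf
  exact isQF_foldr_inf (fun φ hφ => by
    obtain ⟨b, -, rfl⟩ := List.mem_map.1 hφ
    exact h b)

variable {M : Type w} [L.Structure M]

/-- **Existential amalgamation** (Tent–Ziegler 2012, Lemma 3.1.2 applied to `T = Th(M_M)` and
`Δ =` existential formulas, as in the proofs of Thm. 3.1.8 and of Robinson's test): if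
`f : M → N` preserves universal formulas with parameters (`M ≺₁ N` via `f`), then there are an
elementary extension `g : M ↪ₑ[L] K` of `M` and an embedding `h : N ↪[L] K` with `h ∘ f = g`.
The structure `K` lives in the universe `max u v w` of Mathlib's models of `L[[N]]`-theories.
Proof: compactness for (elementary diagram of `M`, transported along `f`) ∪ (quantifier-free
diagram of `N`); finite parts are realized in `M` itself by `exists_realize_of_isQF`. [cite: TentZiegler2012, Lemma 3.1.2] -/
theorem _root_.Literature.ModelTheory.UniversalTheories.PreservesUniversal.exists_elementaryEmbedding [Nonempty M] {f : M → N}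
    (hf : UniversalTheories.PreservesUniversal L f) :
    ∃ (K : Type (max u v w)) (_ : L.Structure K) (g : M ↪ₑ[L] K) (h : N ↪[L] K),
      (h : N → K) ∘ f = g := by
  classical
  let S₁ : Set (L.Formula N) :=
    (fun φ : L.Formula M => φ.relabel f) '' {φ | φ.Realize (_root_.id : M → M)}
  let S₂ : Set (L.Formula N) := {ψ | ψ.IsQF ∧ ψ.Realize (_root_.id : N → N)}
  -- finite parts of `S₁ ∪ S₂` are realized in `M` by an assignment extending `f⁻¹`
  have hfin : ∀ F : Set (L.Formula N), F ⊆ S₁ ∪ S₂ → F.Finite →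
      ∃ v₀ : N → M, ∀ φ ∈ F, φ.Realize v₀ := by
    intro F hF hFfin
    haveI : Finite ↥(F ∩ S₂) := (hFfin.subset Set.inter_subset_left).to_subtype
    let Ψ : L.Formula N := BoundedFormula.iInf (fun ψ : ↥(F ∩ S₂) => (ψ : L.Formula N))
    have hΨqf : Ψ.IsQF := isQF_iInf (fun ψ => ψ.2.2.1)
    have hΨN : Ψ.Realize (_root_.id : N → N) := by
      change BoundedFormula.Realize Ψ _root_.id default
      rw [BoundedFormula.realize_iInf]
      intro ψ
      exact ψ.2.2.2
    -- send `f m ↦ inl m`, other elements of `N` to themselves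
    let r : N → M ⊕ N := fun n => if hn : ∃ m, f m = n then Sum.inl hn.choose else Sum.inr n
    have hr : Sum.elim f _root_.id ∘ r = _root_.id := by
      funext n
      simp only [Function.comp_apply, r]
      split_ifs with hn
      · exact hn.choose_spec
      · rfl
    have hrf : ∀ (w : N → M) (m : M), Sum.elim _root_.id w (r (f m)) = m := by
      intro w m
      have hn : ∃ m', f m' = f m := ⟨m, rfl⟩
      simp only [r, dif_pos hn, Sum.elim_inl]
      exact hf.injective hn.choose_spec
    have hχ : (Ψ.relabel r).Realize (Sum.elim f _root_.id) := by
      rw [Formula.realize_relabel, hr]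
      exact hΨN
    obtain ⟨w, hw⟩ := hf.exists_realize_of_isQF (χ := Ψ.relabel r) (hΨqf.relabel _) hχ
    rw [Formula.realize_relabel] at hw
    refine ⟨Sum.elim _root_.id w ∘ r, fun φ hφ => ?_⟩
    rcases hF hφ with ⟨φ', hφ', rfl⟩ | hφ₂
    · rw [Formula.realize_relabel]
      have hcomp : (Sum.elim _root_.id w ∘ r) ∘ f = _root_.id := funext (hrf w)
      rw [hcomp]
      exact hφ'
    · change BoundedFormula.Realize Ψ (Sum.elim _root_.id w ∘ r) default at hw
      rw [BoundedFormula.realize_iInf] at hw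
      exact hw ⟨φ, hφ, hφ₂⟩
  -- compactness
  have hsat : ((L.lhomWithConstants N).onTheory (∅ : L.Theory) ∪
      Formula.equivSentence '' (S₁ ∪ S₂)).IsSatisfiable := by
    rw [Theory.isSatisfiable_iff_isFinitelySatisfiable]
    intro T0 hT0
    let F : Set (L.Formula N) :=
      {φ | φ ∈ S₁ ∪ S₂ ∧ Formula.equivSentence φ ∈ (T0 : Set L[[N]].Sentence)}
    have hFfin : F.Finite :=
      (T0.finite_toSet.preimage Formula.equivSentence.injective.injOn).subset fun φ hφ => hφ.2
    obtain ⟨v₀, hv₀⟩ := hfin F (fun φ hφ => hφ.1) hFfin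
    have h1 := UniversalTheories.isSatisfiable_union_image_equivSentence_of_realize (∅ : L.Theory) F M v₀ hv₀
    refine h1.mono fun σ hσ => ?_
    rcases hT0 hσ with hσ₁ | ⟨φ, hφ, rfl⟩
    · exact Or.inl hσ₁
    · exact Or.inr ⟨φ, ⟨hφ, hσ⟩, rfl⟩
  obtain ⟨K, _, _, v, -, hv⟩ :=
    (UniversalTheories.isSatisfiable_union_image_equivSentence_iff (∅ : L.Theory) (S₁ ∪ S₂)).1 hsat
  -- `v ∘ f` is elementary
  have hg : ∀ {n : ℕ} (φ : L.Formula (Fin n)) (x : Fin n → M),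
      φ.Realize ((v ∘ f) ∘ x) ↔ φ.Realize x := by
    intro n φ x
    have key : ∀ ψ : L.Formula (Fin n), ψ.Realize x → ψ.Realize ((v ∘ f) ∘ x) := by
      intro ψ hψ
      have hmem : (ψ.relabel x).relabel f ∈ S₁ ∪ S₂ := by
        refine Or.inl ⟨ψ.relabel x, ?_, rfl⟩
        change (ψ.relabel x).Realize _root_.id
        rw [Formula.realize_relabel]
        exact hψ
      have := hv _ hmem
      rw [Formula.realize_relabel, Formula.realize_relabel] at this
      exact this
    refine ⟨fun hx => ?_, key φ⟩
    by_contra hφ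
    exact (Formula.realize_not.1 (key φ.not (Formula.realize_not.2 hφ))) hx
  -- `v` is an embedding
  have hqf : ∀ ψ : L.Formula N, ψ.IsQF → ψ.Realize (_root_.id : N → N) → ψ.Realize v :=
    fun ψ h1 h2 => hv ψ (Or.inr ⟨h1, h2⟩)
  exact ⟨K, inferInstance, ⟨v ∘ f, @fun n φ x => hg φ x⟩, embeddingOfRealizeQF v hqf, rfl⟩

end Amalgamation

/-! ## Step 3: Tarski's chain lemma for a cofinal elementary subfamily -/

section Chain

variable {ι : Type w'} [Preorder ι] [IsDirectedOrder ι] [Nonempty ι]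
  {G : ι → Type w} [∀ i, L.Structure (G i)] (f : ∀ i j, i ≤ j → G i ↪[L] G j)
  [DirectedSystem G fun i j h => f i j h]

/-- **Tarski's chain lemma** (Tent–Ziegler 2012, Thm. 2.1.4, for a cofinal elementary
subfamily).  Let `(G, f)` be a directed system of `L`-structures and embeddings with direct limit
`lim G` (Mathlib's `DirectLimit G f`), and let `S` be a cofinal set of indices such that the
transition maps `f s t` (`s ≤ t` in `S`) are elementary.  Then for `s ∈ S` the canonical map
`G s → lim G` is elementary: it preserves and reflects every bounded formula with parameters.
(For `S = univ` this is the usual chain lemma "the union of an elementary directed family is an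
elementary extension of all its members".) [cite: TentZiegler2012, Theorem 2.1.4] -/
theorem realize_directLimit_of {S : Set ι} (hS : ∀ i, ∃ s ∈ S, i ≤ s)
    (hel : ∀ ⦃s t : ι⦄, s ∈ S → t ∈ S → ∀ (hst : s ≤ t) {n : ℕ} (φ : L.Formula (Fin n))
      (x : Fin n → G s), φ.Realize (f s t hst ∘ x) ↔ φ.Realize x)
    {α : Type*} {k : ℕ} (φ : L.BoundedFormula α k) :
    ∀ {s : ι}, s ∈ S → ∀ (v : α → G s) (xs : Fin k → G s),
      φ.Realize (DirectLimit.of L ι G f s ∘ v) (DirectLimit.of L ι G f s ∘ xs) ↔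
        φ.Realize v xs := by
  induction φ with
  | falsum => intros; rfl
  | equal t₁ t₂ =>
    intro s _ v xs
    exact (IsAtomic.equal t₁ t₂).isQF.realize_embedding (DirectLimit.of L ι G f s)
  | rel R ts =>
    intro s _ v xs
    exact (IsAtomic.rel R ts).isQF.realize_embedding (DirectLimit.of L ι G f s)
  | imp φ ψ ih₁ ih₂ =>
    intro s hs v xs
    simp only [realize_imp, ih₁ hs, ih₂ hs]
  | all φ ih =>
    intro s hs v xs
    simp only [realize_all]
    constructor
    · intro h y
      have h' := h (DirectLimit.of L ι G f s y)
      rw [← Fin.comp_snoc] at h'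
      exact (ih hs v (Fin.snoc xs y)).1 h'
    · intro h z
      obtain ⟨j, z', rfl⟩ := DirectLimit.exists_of z
      obtain ⟨m, hsm, hjm⟩ := exists_ge_ge s j
      obtain ⟨t, ht, hmt⟩ := hS m
      have hst : s ≤ t := hsm.trans hmt
      have hjt : j ≤ t := hjm.trans hmt
      let es : G s ↪ₑ[L] G t := ⟨f s t hst, @fun n ψ x => hel hs ht hst ψ x⟩
      -- transport `∀ y, φ(v, xs, y)` from `G s` to `G t`
      have hall : (φ.all).Realize v xs := by
        simp only [realize_all]
        exact h
      have hall' := (es.map_boundedFormula φ.all v xs).2 hall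
      simp only [realize_all] at hall'
      have h1 := hall' (f j t hjt z')
      -- back to the limit via the induction hypothesis at `t`
      have h2 := (ih ht (es ∘ v) (Fin.snoc (es ∘ xs) (f j t hjt z'))).2 h1
      have hv : (DirectLimit.of L ι G f t) ∘ (es ∘ v) = DirectLimit.of L ι G f s ∘ v := by
        funext a
        exact DirectLimit.of_f
      have hxs : (DirectLimit.of L ι G f t) ∘ Fin.snoc (es ∘ xs) (f j t hjt z') =
          Fin.snoc (DirectLimit.of L ι G f s ∘ xs) (DirectLimit.of L ι G f j z') := by
        rw [Fin.comp_snoc]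
        congr 1
        · funext a
          exact DirectLimit.of_f
        · exact DirectLimit.of_f
      rw [hv, hxs] at h2
      exact h2

/-- Tarski's chain lemma, formula version: for `s` in the cofinal elementary subfamily `S`, the
canonical map `G s → lim G` preserves and reflects all formulas with parameters
(Tent–Ziegler 2012, Thm. 2.1.4). [cite: TentZiegler2012, Theorem 2.1.4] -/
theorem realize_formula_directLimit_of {S : Set ι} (hS : ∀ i, ∃ s ∈ S, i ≤ s)
    (hel : ∀ ⦃s t : ι⦄, s ∈ S → t ∈ S → ∀ (hst : s ≤ t) {n : ℕ} (φ : L.Formula (Fin n))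
      (x : Fin n → G s), φ.Realize (f s t hst ∘ x) ↔ φ.Realize x)
    {α : Type*} (φ : L.Formula α) {s : ι} (hs : s ∈ S) (v : α → G s) :
    φ.Realize (DirectLimit.of L ι G f s ∘ v) ↔ φ.Realize v := by
  have h := realize_directLimit_of f hS hel φ hs v default
  rw [show (DirectLimit.of L ι G f s : G s → FirstOrder.Language.DirectLimit G f) ∘ (default : Fin 0 → G s) =
    default from Subsingleton.elim _ _] at h
  exact h

/-- Tarski's chain lemma packaged as an elementary embedding `G s ↪ₑ[L] lim G` for `s` in the
cofinal elementary subfamily (Tent–Ziegler 2012, Thm. 2.1.4). [cite: TentZiegler2012, Theorem 2.1.4] -/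
noncomputable def elementaryEmbeddingDirectLimitOf {S : Set ι} (hS : ∀ i, ∃ s ∈ S, i ≤ s)
    (hel : ∀ ⦃s t : ι⦄, s ∈ S → t ∈ S → ∀ (hst : s ≤ t) {n : ℕ} (φ : L.Formula (Fin n))
      (x : Fin n → G s), φ.Realize (f s t hst ∘ x) ↔ φ.Realize x)
    {s : ι} (hs : s ∈ S) : G s ↪ₑ[L] FirstOrder.Language.DirectLimit G f :=
  ⟨DirectLimit.of L ι G f s, @fun _ φ x => realize_formula_directLimit_of f hS hel φ hs x⟩

/-- The elementary embedding of `elementaryEmbeddingDirectLimitOf` is the canonical map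
`DirectLimit.of`. [folklore] -/
@[simp]
theorem coe_elementaryEmbeddingDirectLimitOf {S : Set ι} (hS : ∀ i, ∃ s ∈ S, i ≤ s)
    (hel : ∀ ⦃s t : ι⦄, s ∈ S → t ∈ S → ∀ (hst : s ≤ t) {n : ℕ} (φ : L.Formula (Fin n))
      (x : Fin n → G s), φ.Realize (f s t hst ∘ x) ↔ φ.Realize x)
    {s : ι} (hs : s ∈ S) :
    ⇑(elementaryEmbeddingDirectLimitOf f hS hel hs) = DirectLimit.of L ι G f s :=
  rfl

end Chain

/-! ## Chains indexed by `ℕ`: the transition maps `natLERec` -/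

section NatChain

variable {G' : ℕ → Type w} [∀ i, L.Structure (G' i)] (f' : ∀ n : ℕ, G' n ↪[L] G' (n + 1))

/-- The transition map of an `ℕ`-chain from `m` to `m` is the identity. [folklore] -/
theorem natLERec_self (m : ℕ) (h : m ≤ m) :
    DirectedSystem.natLERec f' m m h = Embedding.refl L _ :=
  Nat.leRecOn_self _

/-- The transition map of an `ℕ`-chain from `m` to `n + 1` is the one to `n` followed by the
`n`-th link. [folklore] -/
theorem natLERec_succ (m n : ℕ) (h1 : m ≤ n) (h2 : m ≤ n + 1) :
    DirectedSystem.natLERec f' m (n + 1) h2 = (f' n).comp (DirectedSystem.natLERec f' m n h1) :=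
  Nat.leRecOn_succ h1 _

/-- Pointwise form of `natLERec_succ`. [folklore] -/
theorem natLERec_succ_apply (m n : ℕ) (h1 : m ≤ n) (h2 : m ≤ n + 1) (x : G' m) :
    DirectedSystem.natLERec f' m (n + 1) h2 x = f' n (DirectedSystem.natLERec f' m n h1 x) := by
  rw [natLERec_succ f' m n h1 h2]
  rfl

/-- The link `f' m` of an `ℕ`-chain is its transition map from `m` to `m + 1`. [folklore] -/
theorem natLERec_succ_self (m : ℕ) (h : m ≤ m + 1) (x : G' m) :
    DirectedSystem.natLERec f' m (m + 1) h x = f' m x := by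
  rw [natLERec_succ_apply f' m m le_rfl h, natLERec_self]
  rfl

/-- In an `ℕ`-chain in which every *double* link `G' k → G' (k + 2)` is elementary, the
transition maps `G' s → G' (s + 2d)` are elementary. [folklore] -/
theorem realize_natLERec_of_double
    (h2 : ∀ (k : ℕ) {n : ℕ} (φ : L.Formula (Fin n)) (x : Fin n → G' k),
      φ.Realize (f' (k + 1) ∘ f' k ∘ x) ↔ φ.Realize x)
    (s : ℕ) : ∀ (d t : ℕ) (hst : s ≤ t), t = s + (d + d) → ∀ {n : ℕ} (φ : L.Formula (Fin n))
      (x : Fin n → G' s), φ.Realize (DirectedSystem.natLERec f' s t hst ∘ x) ↔ φ.Realize x := by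
  intro d
  induction d with
  | zero =>
    intro t hst ht n φ x
    obtain rfl : t = s := by omega
    rw [natLERec_self]
    rfl
  | succ d ih =>
    intro t hst ht n φ x
    obtain rfl : t = s + (d + d) + 1 + 1 := by omega
    have hle : s ≤ s + (d + d) := by omega
    have hcomp : (DirectedSystem.natLERec f' s (s + (d + d) + 1 + 1) hst : G' s → _) ∘ x =
        f' (s + (d + d) + 1) ∘ f' (s + (d + d)) ∘ (DirectedSystem.natLERec f' s (s + (d + d)) hle ∘ x) := by
      funext i
      simp only [Function.comp_apply]
      rw [natLERec_succ_apply f' s _ (by omega) hst, natLERec_succ_apply f' s _ hle]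
    rw [hcomp, h2, ih (s + (d + d)) hle rfl]

end NatChain

/-! ## Step 4: the interleaved chain and Robinson's test -/

section Robinson

variable {T : L.Theory}

/-- A stage of the Robinson chain: two models `A ↪ B` of `T` (Tent–Ziegler 2012, proof of
Thm. 3.1.8). [cite: TentZiegler2012, Theorem 3.1.8] -/
structure ECStage (T : L.Theory) where
  /-- the smaller model -/
  A : Theory.ModelType.{u, v, max u v} T
  /-- the larger model -/
  B : Theory.ModelType.{u, v, max u v} T
  /-- the embedding `A ↪ B` -/
  emb : A ↪[L] B

/-- The data produced by one amalgamation step over a stage `A ↪ B`: a model `C` with `B ↪ C`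
such that the composite `A ↪ C` is elementary (Tent–Ziegler 2012, proof of Thm. 3.1.8). [cite: TentZiegler2012, Theorem 3.1.8] -/
structure ECStep (s : ECStage T) where
  /-- the amalgam -/
  C : Theory.ModelType.{u, v, max u v} T
  /-- the embedding of the larger model into the amalgam -/
  next : s.B ↪[L] C
  /-- the composite embedding of the smaller model is elementary -/
  elem : ∀ {n : ℕ} (φ : L.Formula (Fin n)) (x : Fin n → s.A),
    φ.Realize (next ∘ s.emb ∘ x) ↔ φ.Realize x

/-- If `T` has existentially closed models, every stage admits an amalgamation step
(by `PreservesUniversal.exists_elementaryEmbedding`). [cite: TentZiegler2012, Lemma 3.1.2] -/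
theorem nonempty_ecStep (hT : T.ModelsExistentiallyClosed) (s : ECStage T) :
    Nonempty (ECStep s) := by
  obtain ⟨K, _, g, h, hcomp⟩ := (hT s.A s.B s.emb).exists_elementaryEmbedding
  haveI : K ⊨ T := (g.theory_model_iff T).1 inferInstance
  haveI : Nonempty K := (inferInstance : Nonempty s.A).map g
  refine ⟨⟨Theory.ModelType.of T K, h, @fun n φ x => ?_⟩⟩
  have key := g.map_formula φ x
  rw [← hcomp] at key
  exact key

/-- A chosen amalgamation step. [folklore] -/
noncomputable def ecStep (hT : T.ModelsExistentiallyClosed) (s : ECStage T) : ECStep s :=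
  Classical.choice (nonempty_ecStep hT s)

/-- The Robinson chain `M = A₀ ↪ N = A₁ ↪ A₂ ↪ ⋯`: stage `k + 1` is `(Bₖ, Cₖ)` where `Cₖ` is the
amalgam of stage `k` (Tent–Ziegler 2012, proof of Thm. 3.1.8). [cite: TentZiegler2012, Theorem 3.1.8] -/
noncomputable def ecChain (hT : T.ModelsExistentiallyClosed) (s₀ : ECStage T) : ℕ → ECStage T
  | 0 => s₀
  | k + 1 => ⟨(ecChain hT s₀ k).B, (ecStep hT (ecChain hT s₀ k)).C,
      (ecStep hT (ecChain hT s₀ k)).next⟩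

/-- The carriers `Aₖ` of the Robinson chain. [folklore] -/
abbrev ECSeq (hT : T.ModelsExistentiallyClosed) (s₀ : ECStage T) (k : ℕ) : Type (max u v) :=
  (ecChain hT s₀ k).A

/-- The links `Aₖ ↪ Aₖ₊₁` of the Robinson chain. [folklore] -/
noncomputable def ecEmb (hT : T.ModelsExistentiallyClosed) (s₀ : ECStage T) (k : ℕ) :
    ECSeq hT s₀ k ↪[L] ECSeq hT s₀ (k + 1) :=
  (ecChain hT s₀ k).emb

/-- Every double link `Aₖ ↪ Aₖ₊₂` of the Robinson chain is elementary. [folklore] -/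
theorem realize_ecEmb_ecEmb (hT : T.ModelsExistentiallyClosed) (s₀ : ECStage T) (k : ℕ)
    {n : ℕ} (φ : L.Formula (Fin n)) (x : Fin n → ECSeq hT s₀ k) :
    φ.Realize (ecEmb hT s₀ (k + 1) ∘ ecEmb hT s₀ k ∘ x) ↔ φ.Realize x :=
  (ecStep hT (ecChain hT s₀ k)).elem φ x

end Robinson

end Literature.ModelTheory.ModelCompleteness

namespace Literature.ModelTheory.ModelCompleteness

open UniversalTheories

/-- **Robinson's test holds** (Tent–Ziegler 2012, Lemma 3.2.7, (b) ⇒ (a)): a theory all of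
whose models are existentially closed in all their extension models is model complete.  Proof by
the Robinson chain `M = A₀ ↪ N = A₁ ↪ A₂ ↪ ⋯` (`ecChain`) and Tarski's chain lemma for the even
and the odd indices. [cite: TentZiegler2012, Lemma 3.2.7] -/
theorem robinsonTest_holds : robinsonTest.{u, v} := by
  intro L T hT M N f n φ x
  let s₀ : ECStage T := ⟨M, N, f⟩
  let f' : ∀ k, ECSeq hT s₀ k ↪[L] ECSeq hT s₀ (k + 1) := ecEmb hT s₀
  -- parity classes are cofinal and their transition maps are elementary
  have hS : ∀ (p i : ℕ), ∃ t ∈ {t : ℕ | ∃ d, t = p + (d + d)}, i ≤ t :=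
    fun p i => ⟨p + (i + i), ⟨i, rfl⟩, by omega⟩
  have hel : ∀ (p : ℕ) ⦃s t : ℕ⦄, s ∈ {t : ℕ | ∃ d, t = p + (d + d)} →
      t ∈ {t : ℕ | ∃ d, t = p + (d + d)} → ∀ (hst : s ≤ t) {n : ℕ} (φ : L.Formula (Fin n))
      (x : Fin n → ECSeq hT s₀ s),
      φ.Realize (DirectedSystem.natLERec f' s t hst ∘ x) ↔ φ.Realize x := by
    rintro p s t ⟨d₁, rfl⟩ ⟨d₂, rfl⟩ hst n φ x
    exact realize_natLERec_of_double f' (realize_ecEmb_ecEmb hT s₀) _ (d₂ - d₁) _ hst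
      (by omega) φ x
  have h0 : (0 : ℕ) ∈ {t : ℕ | ∃ d, t = 0 + (d + d)} := ⟨0, rfl⟩
  have h1 : (1 : ℕ) ∈ {t : ℕ | ∃ d, t = 1 + (d + d)} := ⟨0, rfl⟩
  have e0 := realize_formula_directLimit_of (fun i j h => DirectedSystem.natLERec f' i j h)
    (hS 0) (hel 0) φ h0 x
  have e1 := realize_formula_directLimit_of (fun i j h => DirectedSystem.natLERec f' i j h)
    (hS 1) (hel 1) φ h1 (f ∘ x)
  have hcomp : (DirectLimit.of L ℕ (ECSeq hT s₀) (fun i j h => DirectedSystem.natLERec f' i j h) 1)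
      ∘ (f ∘ x) =
      DirectLimit.of L ℕ (ECSeq hT s₀) (fun i j h => DirectedSystem.natLERec f' i j h) 0 ∘ x := by
    funext i
    simp only [Function.comp_apply]
    have hx : (f : M → N) (x i) = DirectedSystem.natLERec f' 0 1 (by omega) (x i) :=
      (natLERec_succ_self f' 0 (by omega) (x i)).symm
    rw [hx]
    exact DirectLimit.of_f
  have e2 : φ.Realize ((DirectLimit.of L ℕ (ECSeq hT s₀)
        (fun i j h => DirectedSystem.natLERec f' i j h) 1) ∘ (f ∘ x)) ↔
      φ.Realize ((DirectLimit.of L ℕ (ECSeq hT s₀)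
        (fun i j h => DirectedSystem.natLERec f' i j h) 0) ∘ x) := by
    rw [hcomp]
  exact e1.symm.trans (e2.trans e0)

/-- Robinson's test as an equivalence (Tent–Ziegler 2012, Lemma 3.2.7, (a) ⇔ (b)): `T` is model
complete iff all models of `T` are existentially closed in all their extension models. [cite: TentZiegler2012, Lemma 3.2.7] -/
theorem isModelComplete_iff_modelsExistentiallyClosed {L : FirstOrder.Language.{u, v}} (T : L.Theory) :
    T.IsModelComplete ↔ T.ModelsExistentiallyClosed :=
  ⟨fun h => h.modelsExistentiallyClosed, fun h => robinsonTest_holds T h⟩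

end Literature.ModelTheory.ModelCompleteness
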